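import Literature.NumberTheory.LFunctions.DedekindZetaHeckeSymmetry
import HarnessLib

/-!
# Hecke's functional equation `Λ_K(1 - s) = Λ_K(s)` — discharge of `completedDedekindZeta_one_sub`

Topic `Literature/NumberTheory/LFunctions`, sibling proofs file (D-0014) of `DedekindZeta.lean`,
whose named fact `Literature.NumberTheory.LFunctions.completedDedekindZeta_one_sub` states, for a
number field `K`, the functional equation `Λ_K(1 - s) = Λ_K(s)` of the completed Dedekind zeta
function `Λ_K(s) = |d_K|^{s/2} Γ_ℝ(s)^{r₁} Γ_ℂ(s)^{r₂} ζ_K(s)` (`completedDedekindZeta`,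
`dedekindGammaFactor`; Hecke 1917; Neukirch, *Algebraic Number Theory*, Ch. VII (5.10) Corollary),
off the integers (where the pointwise product takes junk values, see the module docstring of
`DedekindZeta.lean`). This file PROVES it for every number field
(`Literature.NumberTheory.LFunctions.completedDedekindZeta_one_sub_holds`), completing the
formalisation of Neukirch VII §5 carried out in `DedekindZetaTheta*.lean`,
`DedekindZetaMellin*.lean`, `DedekindZetaPoissonProofs.lean`, `DedekindZetaClassSumCont.lean` and
`DedekindZetaHeckeSymmetry.lean`; no new definitions.

## Proof

* `dedekindGammaFactor_eq`: `|d_K|^{s/2} Γ_ℝ(s)^{r₁} Γ_ℂ(s)^{r₂} = |d_K|^{s/2} 2^{r₂} A(s/2)` with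
  Hecke's Euler factor at infinity `A = gammaFactorC K` (`gammaFactorC_half`, splitting the places,
  Mathlib `NumberField.InfinitePlace.prod_eq_prod_mul_prod`); `A(s/2) ≠ 0` off the integers
  (`gammaFactorC_half_ne_zero`).
* `dedekindZetaCont_eq_sum_classFrontFactor_mul_Λ`: for `s ∉ {0, 1}`,
  `ζ_K(s) = ∑_C c_K⁻¹ w⁻¹ 𝔑(J_C)^s A(s/2)⁻¹ Λ_{J_C}(s/2)` (unfolding of `classSumCont`,
  `DedekindZetaClassSumCont.lean`; `Λ_{J_C}` is Mathlib's `WeakFEPair.Λ` of the FE-pair of the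
  integral representative `J_C` of `C⁻¹`). Hence, off the integers,
  `Λ_K(s) = 2^{r₂} c_K⁻¹ w⁻¹ ∑_C |d_K|^{s/2} 𝔑(J_C)^s Λ_{J_C}(s/2)`.
* `exists_classDuality`: a bijection `σ` of the class group and `v_C ∈ K^×` with
  `(J_C 𝔡)⁻¹ = v_C J_{σ C}` (two fractional ideals of the same class differ by a principal factor,
  `exists_eq_spanSingleton_mul_of_mk_eq`, Mathlib `ClassGroup.mk_eq_one_iff`) and
  `𝔑(J_{σ C}) |d_K| 𝔑(J_C) |N(v_C)| = 1` (`absNorm_dual`).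
* Assembly (`completedDedekindZeta_one_sub_holds`): by Mathlib's Mellin principle
  `Λ_{J}((1-s)/2) = ε_J Λ_{J^symm}(s/2)` (`WeakFEPair.functional_equation`, Neukirch VII (1.4)),
  `J^symm = (J𝔡)⁻¹` (`heckePair_symm`) and the scaling
  `Λ_{v 𝔞}(z) = |N(v)|^{-2z} Λ_𝔞(z)` (`heckePair_Λ_spanSingleton_mul`), each summand of `Λ_K(1-s)`
  is `|d_K|^{(1-s)/2} 𝔑(J_C)^{1-s} ε_C |N(v_C)|^{-s} Λ_{J_{σ C}}(s/2)
  = |d_K|^{s/2} 𝔑(J_{σ C})^s Λ_{J_{σ C}}(s/2)` (the norm relation), and re-indexing by `σ`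
  gives `Λ_K(s)`.

## References

* J. Neukirch, *Algebraic Number Theory*, Grundlehren 322, Springer 1999, Ch. VII (1.4), (4.3),
  (5.3), (5.9)–(5.11). [NeukirchANT1999]
* E. Hecke, *Über die Zetafunktion beliebiger algebraischer Zahlkörper*, Nachr. Ges. Wiss.
  Göttingen (1917), 77–89. [Hecke1917]
* Mathlib: `NumberTheory.LSeries.AbstractFuncEq` (`WeakFEPair`, D. Loeffler).
-/

noncomputable section

open scoped NumberField nonZeroDivisors
open NumberField NumberField.InfinitePlace NumberField.Units MeasureTheory Complex Filter Topology Set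

namespace Literature.NumberTheory.LFunctions.NumberField

variable {K : Type*} [Field K] [NumberField K]

/-! ## Hecke's gamma factor versus Deligne's normalisation -/

omit [NumberField K] in
/-- At a real place, Hecke's local factor `(π e_w)^{-e_w z} Γ(e_w z)` at `z = s/2` is `Γ_ℝ(s)`
(`e_w = 1`; Mathlib `Complex.Gammaℝ`). [folklore] -/
theorem heckeLocalFactor_isReal (w : {w : InfinitePlace K // IsReal w}) (s : ℂ) :
    (((1 / (Real.pi * mult w.1) : ℝ)) : ℂ) ^ ((mult w.1 : ℂ) * (s / 2)) *
      Complex.Gamma ((mult w.1 : ℂ) * (s / 2)) = Gammaℝ s := by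
  have hπ : (Real.pi : ℂ).arg ≠ Real.pi := by
    rw [Complex.arg_ofReal_of_nonneg Real.pi_pos.le]; exact Real.pi_ne_zero.symm
  have hbase : (((1 / Real.pi : ℝ)) : ℂ) = (Real.pi : ℂ)⁻¹ := by push_cast; ring
  simp only [mult_isReal, Nat.cast_one, one_mul, mul_one]
  rw [hbase, Complex.Gammaℝ_def, Complex.inv_cpow _ _ hπ, ← Complex.cpow_neg, neg_div]

omit [NumberField K] in
/-- At a complex place, Hecke's local factor `(π e_w)^{-e_w z} Γ(e_w z)` at `z = s/2` is
`Γ_ℂ(s)/2 = (2π)^{-s} Γ(s)` (`e_w = 2`; Mathlib `Complex.Gammaℂ`). [folklore] -/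
theorem heckeLocalFactor_isComplex (w : {w : InfinitePlace K // IsComplex w}) (s : ℂ) :
    (((1 / (Real.pi * mult w.1) : ℝ)) : ℂ) ^ ((mult w.1 : ℂ) * (s / 2)) *
      Complex.Gamma ((mult w.1 : ℂ) * (s / 2)) = Gammaℂ s / 2 := by
  have h2π : (2 * (Real.pi : ℂ)).arg ≠ Real.pi := by
    rw [show (2 * (Real.pi : ℂ)) = ((2 * Real.pi : ℝ) : ℂ) by push_cast; ring,
      Complex.arg_ofReal_of_nonneg (by positivity)]
    exact Real.pi_ne_zero.symm
  have hs : ((2 : ℕ) : ℂ) * (s / 2) = s := by push_cast; ring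
  have hbase : (((1 / (Real.pi * ((2 : ℕ) : ℝ)) : ℝ)) : ℂ) = (2 * (Real.pi : ℂ))⁻¹ := by
    push_cast; ring
  rw [mult_isComplex, hs, hbase, Complex.Gammaℂ_def, Complex.inv_cpow _ _ h2π, ← Complex.cpow_neg]
  ring

open scoped Classical in
/-- `A(s/2) = Γ_ℝ(s)^{r₁} (Γ_ℂ(s)/2)^{r₂}` for Hecke's Euler factor at infinity `A = gammaFactorC K`
(Neukirch VII (5.3), (4.3); split the places into real and complex ones, Mathlib
`NumberField.InfinitePlace.prod_eq_prod_mul_prod`). [folklore] -/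
theorem gammaFactorC_half (s : ℂ) :
    gammaFactorC K (s / 2) = Gammaℝ s ^ nrRealPlaces K * (Gammaℂ s / 2) ^ nrComplexPlaces K := by
  unfold gammaFactorC
  rw [prod_eq_prod_mul_prod]
  simp_rw [heckeLocalFactor_isReal, heckeLocalFactor_isComplex]
  rw [Finset.prod_const, Finset.prod_const, Finset.card_univ, Finset.card_univ]

/-- **Hecke's gamma factor in terms of `A`**: `|d_K|^{s/2} Γ_ℝ(s)^{r₁} Γ_ℂ(s)^{r₂}`
(`dedekindGammaFactor`, Deligne's normalisation) equals `|d_K|^{s/2} · 2^{r₂} · A(s/2)`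
(Neukirch VII (5.10): `Z_K(s) = |d_K|^{s/2} π^{-ns/2} Γ_K(s/2) ζ_K(s)` with (4.3)
`L_ℂ(s) = 2^{1-s}… `, i.e. the factor `2^{r₂}`). [folklore] -/
theorem dedekindGammaFactor_eq (s : ℂ) :
    dedekindGammaFactor K s =
      ((discr K).natAbs : ℂ) ^ (s / 2) * 2 ^ nrComplexPlaces K * gammaFactorC K (s / 2) := by
  rw [dedekindGammaFactor, gammaFactorC_half, div_pow]
  have h2 : (2 : ℂ) ^ nrComplexPlaces K ≠ 0 := pow_ne_zero _ two_ne_zero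
  field_simp

omit [NumberField K] in
/-- `e_w ∈ {1, 2}`. [folklore] -/
theorem mult_eq_one_or_two (w : InfinitePlace K) : mult w = 1 ∨ mult w = 2 := by
  unfold mult; split_ifs <;> simp

/-- `A(s/2) ≠ 0` off the integers (the Gamma factors `Γ(s/2)`, `Γ(s)` have their poles at
non-positive integers `s`). [folklore] -/
theorem gammaFactorC_half_ne_zero {s : ℂ} (hs : ∀ n : ℤ, s ≠ n) : gammaFactorC K (s / 2) ≠ 0 := by
  unfold gammaFactorC
  refine Finset.prod_ne_zero_iff.mpr fun w _ ↦ mul_ne_zero ?_ ?_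
  · exact fun h ↦ one_div_pi_mul_mult_ne_zero w ((Complex.cpow_eq_zero_iff _ _).mp h).1
  · refine Complex.Gamma_ne_zero fun m hm ↦ ?_
    rcases mult_eq_one_or_two w with h | h
    · rw [h, Nat.cast_one, one_mul] at hm
      refine hs (-(2 * (m : ℤ))) ?_
      have : s = 2 * (s / 2) := by ring
      rw [this, hm]; push_cast; ring
    · rw [h] at hm
      refine hs (-(m : ℤ)) ?_
      have : s = ((2 : ℕ) : ℂ) * (s / 2) := by push_cast; ring
      rw [this, hm]; push_cast; ring

/-! ## `ζ_K` as a sum of completed Mellin transforms of the class representatives -/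

/-- `D_C(s) = B_C(s) · Λ_{J_C}(s/2)` for `s ≠ 0`: the continued class partial zeta function is the
front factor times Mathlib's meromorphic `Λ` of the FE-pair of the representative `J_C`
(`Λ = Λ₀ − 1/(s/2) − ε/(1/2 − s/2)` with `f₀ = g₀ = 1`, and `B₀ = B/(s/2)`; Neukirch VII (5.9)).
[cite: NeukirchANT1999, Ch. VII (5.9)] -/
theorem classSumCont_eq_mul_Λ (hinv : thetaIdeal_inv K) (C : ClassGroup (𝓞 K)) {s : ℂ}
    (hs : s ≠ 0) : classSumCont hinv C s = classFrontFactor K C s * (classPair hinv C).Λ (s / 2) := by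
  have hΛ : (classPair hinv C).Λ (s / 2) = (classPair hinv C).Λ₀ (s / 2) - 1 / (s / 2) -
      (classPair hinv C).ε / (((1 / 2 : ℝ) : ℂ) - s / 2) := by
    have hf0 : (classPair hinv C).f₀ = 1 := rfl
    have hg0 : (classPair hinv C).g₀ = 1 := rfl
    have hk : ((classPair hinv C).k : ℂ) = ((1 / 2 : ℝ) : ℂ) := rfl
    rw [WeakFEPair.Λ, hf0, hg0, hk, smul_eq_mul, smul_eq_mul, mul_one, mul_one]
  rw [hΛ, classSumCont, classFrontFactor₀_eq K C hs]
  ring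

/-- **`ζ_K(s) = ∑_C B_C(s) Λ_{J_C}(s/2)`** for `s ∉ {0, 1}`, with
`B_C(s) = c_K⁻¹ w⁻¹ 𝔑(J_C)^s A(s/2)⁻¹` (`classFrontFactor`) and the integral representatives `J_C`
of the inverse classes (`classRep`) (Neukirch VII (5.9)–(5.11): `ζ_K = ∑_𝔎 ζ(𝔎, ·)`).
[cite: NeukirchANT1999, Ch. VII (5.11) (i)] -/
theorem dedekindZetaCont_eq_sum_classFrontFactor_mul_Λ (hinv : thetaIdeal_inv K) {s : ℂ}
    (hs0 : s ≠ 0) (hs1 : s ≠ 1) :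
    dedekindZetaCont K s =
      ∑ C : ClassGroup (𝓞 K), classFrontFactor K C s * (classPair hinv C).Λ (s / 2) := by
  rw [dedekindZetaCont_eq_sum_classSumCont hinv hs1]
  exact Finset.sum_congr rfl fun C _ ↦ classSumCont_eq_mul_Λ hinv C hs0

/-! ## Class bookkeeping: duals of the representatives -/

/-- Two nonzero fractional ideals with the same ideal class differ by a principal factor:
`I = (v) J` with `v ∈ K^×` (Mathlib `ClassGroup.mk_eq_one_iff`). [folklore] -/
theorem exists_eq_spanSingleton_mul_of_mk_eq {I J : (FractionalIdeal (𝓞 K)⁰ K)ˣ}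
    (h : ClassGroup.mk K I = ClassGroup.mk K J) :
    ∃ v : K, v ≠ 0 ∧
      (I : FractionalIdeal (𝓞 K)⁰ K) = FractionalIdeal.spanSingleton (𝓞 K)⁰ v * J := by
  have h1 : ClassGroup.mk K (I * J⁻¹) = 1 := by rw [map_mul, map_inv, h, mul_inv_cancel]
  rw [ClassGroup.mk_eq_one_iff] at h1
  obtain ⟨v, hv⟩ := @Submodule.IsPrincipal.principal _ _ _ _ _ _ h1
  have hIJ : ((I * J⁻¹ : (FractionalIdeal (𝓞 K)⁰ K)ˣ) : FractionalIdeal (𝓞 K)⁰ K) =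
      FractionalIdeal.spanSingleton (𝓞 K)⁰ v := by
    apply FractionalIdeal.coeToSubmodule_injective
    simp only [FractionalIdeal.coe_spanSingleton]
    exact hv
  refine ⟨v, fun hv0 ↦ ?_, ?_⟩
  · apply (I * J⁻¹).ne_zero
    rw [hIJ, hv0, FractionalIdeal.spanSingleton_zero]
  · have : (I : FractionalIdeal (𝓞 K)⁰ K) =
        ((I * J⁻¹ : (FractionalIdeal (𝓞 K)⁰ K)ˣ) : FractionalIdeal (𝓞 K)⁰ K) * J := by
      rw [← Units.val_mul, inv_mul_cancel_right]
    rw [this, hIJ]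

/-- **Duality on the class group for the functional equation.** There are a bijection `σ` of the
class group and elements `v_C ∈ K^×` such that the dual `(J_C 𝔡)⁻¹` of the representative `J_C`
of `C⁻¹` (`classRep`) is `v_C · J_{σ(C)}`, and consequently
`𝔑(J_{σ C}) · |d_K| · 𝔑(J_C) · |N(v_C)| = 1` (`absNorm_dual`). Here `σ(C) = [𝔡] C⁻¹… `, i.e.
`C ↦ σ(C)` realises Neukirch's pairing `𝔎 𝔎' = [𝔡]` of VII (5.9)–(5.10) on the level of the
chosen representatives. [cite: NeukirchANT1999, Ch. VII (5.10)] -/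
theorem exists_classDuality :
    ∃ (σ : ClassGroup (𝓞 K) ≃ ClassGroup (𝓞 K)) (v : ClassGroup (𝓞 K) → K), ∀ C, v C ≠ 0 ∧
      FractionalIdeal.dual ℤ ℚ
          (((classRep K C : (Ideal (𝓞 K))⁰) : Ideal (𝓞 K)) : FractionalIdeal (𝓞 K)⁰ K) =
        FractionalIdeal.spanSingleton (𝓞 K)⁰ (v C) *
          (((classRep K (σ C) : (Ideal (𝓞 K))⁰) : Ideal (𝓞 K)) : FractionalIdeal (𝓞 K)⁰ K) ∧
      (Ideal.absNorm (classRep K (σ C) : Ideal (𝓞 K)) : ℚ) * (discr K).natAbs *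
          Ideal.absNorm (classRep K C : Ideal (𝓞 K)) * |(Algebra.norm ℚ (v C) : ℚ)| = 1 := by
  -- the class `δ` of `𝔡⁻¹ = dual 1`
  set δu : (FractionalIdeal (𝓞 K)⁰ K)ˣ := Units.mk0 (FractionalIdeal.dual ℤ ℚ (1 : FractionalIdeal (𝓞 K)⁰ K))
    (FractionalIdeal.dual_ne_zero ℤ ℚ one_ne_zero) with hδu
  set δ : ClassGroup (𝓞 K) := ClassGroup.mk K δu with hδ
  -- `σ C = δ⁻¹ C⁻¹`, an involution
  set σf : ClassGroup (𝓞 K) → ClassGroup (𝓞 K) := fun C ↦ δ⁻¹ * C⁻¹ with hσf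
  have hσinv : Function.Involutive σf := fun C ↦ by
    simp only [hσf, mul_inv_rev, inv_inv]
    rw [mul_comm C δ, ← mul_assoc, inv_mul_cancel, one_mul]
  let σ : ClassGroup (𝓞 K) ≃ ClassGroup (𝓞 K) := hσinv.toPerm σf
  -- the unit fractional ideals of the representatives and of their duals
  have hJ0 : ∀ C : ClassGroup (𝓞 K),
      (((classRep K C : (Ideal (𝓞 K))⁰) : Ideal (𝓞 K)) : FractionalIdeal (𝓞 K)⁰ K) ≠ 0 := fun C ↦
    coeIdeal_ne_zero_of_mem_nonZeroDivisors (classRep K C)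
  have hmkJ : ∀ C : ClassGroup (𝓞 K),
      ClassGroup.mk K (FractionalIdeal.mk0 K (classRep K C)) = C⁻¹ := fun C ↦ by
    rw [ClassGroup.mk_mk0, mk0_classRep]
  have hdual : ∀ C : ClassGroup (𝓞 K),
      Units.mk0 _ (FractionalIdeal.dual_ne_zero ℤ ℚ (hJ0 C)) = δu * (FractionalIdeal.mk0 K (classRep K C))⁻¹ := by
    intro C
    ext1
    rw [Units.val_mul, Units.val_inv_eq_inv_val, Units.val_mk0, hδu, Units.val_mk0,
      FractionalIdeal.coe_mk0, FractionalIdeal.dual_eq_mul_inv ℤ ℚ]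
  have hmk : ∀ C : ClassGroup (𝓞 K),
      ClassGroup.mk K (Units.mk0 _ (FractionalIdeal.dual_ne_zero ℤ ℚ (hJ0 C))) =
        ClassGroup.mk K (FractionalIdeal.mk0 K (classRep K (σ C))) := by
    intro C
    rw [hdual, map_mul, map_inv, hmkJ, hmkJ, inv_inv]
    show δ * C = (δ⁻¹ * C⁻¹)⁻¹
    rw [mul_inv_rev, inv_inv, inv_inv, mul_comm]
  choose v hv0 hv using fun C ↦ exists_eq_spanSingleton_mul_of_mk_eq (hmk C)
  refine ⟨σ, v, fun C ↦ ⟨hv0 C, ?_, ?_⟩⟩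
  · have h := hv C
    rw [Units.val_mk0, FractionalIdeal.coe_mk0] at h
    exact h
  · -- norms
    have h := hv C
    rw [Units.val_mk0, FractionalIdeal.coe_mk0] at h
    have hN := congr_arg FractionalIdeal.absNorm h
    rw [absNorm_dual, map_mul, FractionalIdeal.absNorm_span_singleton, FractionalIdeal.coeIdeal_absNorm,
      FractionalIdeal.coeIdeal_absNorm] at hN
    have hC : (Ideal.absNorm (classRep K C : Ideal (𝓞 K)) : ℚ) ≠ 0 :=
      Nat.cast_ne_zero.mpr (Ideal.absNorm_pos_of_nonZeroDivisors (classRep K C)).ne'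
    have hd : ((discr K).natAbs : ℚ) ≠ 0 :=
      Nat.cast_ne_zero.mpr (Int.natAbs_ne_zero.mpr (discr_ne_zero K))
    field_simp at hN
    linear_combination -hN

end Literature.NumberTheory.LFunctions.NumberField

namespace Literature.NumberTheory.LFunctions.NumberField

variable {K : Type*} [Field K] [NumberField K]

/-! ## The functional equation `Λ_K(1 - s) = Λ_K(s)` -/

omit [NumberField K] in
/-- `r^e = exp(e log r)` for real `r > 0` and complex `e`. [folklore] -/
theorem ofReal_cpow_eq_exp {r : ℝ} (hr : 0 < r) (e : ℂ) :
    ((r : ℂ)) ^ e = Complex.exp ((Real.log r : ℂ) * e) := by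
  rw [Complex.cpow_def_of_ne_zero (Complex.ofReal_ne_zero.mpr hr.ne'), Complex.ofReal_log hr.le]

/-- The constant `ε_C = (𝔑(J_C) √|d_K|)⁻¹` of the FE-pair of the representative `J_C`, as an
exponential: `ε_C = exp(-(log 𝔑(J_C) + (log |d_K|)/2))`. [folklore] -/
theorem classPair_ε_eq_exp (hinv : thetaIdeal_inv K) (C : ClassGroup (𝓞 K)) :
    (classPair hinv C).ε = Complex.exp (-((Real.log (Ideal.absNorm (classRep K C : Ideal (𝓞 K))) : ℂ) +
      (Real.log ((discr K).natAbs) : ℂ) / 2)) := by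
  have hnC : (0 : ℝ) < Ideal.absNorm (classRep K C : Ideal (𝓞 K)) :=
    Nat.cast_pos.mpr (Ideal.absNorm_pos_of_nonZeroDivisors (classRep K C))
  have hdn : (0 : ℝ) < (discr K).natAbs := Nat.cast_pos.mpr (Int.natAbs_pos.mpr (discr_ne_zero K))
  show ((((FractionalIdeal.absNorm (((classRep K C : (Ideal (𝓞 K))⁰) : Ideal (𝓞 K)) :
      FractionalIdeal (𝓞 K)⁰ K) : ℝ) * Real.sqrt |(discr K : ℝ)|)⁻¹ : ℝ) : ℂ) = _
  have hsq : Real.sqrt |(discr K : ℝ)| = Real.exp (Real.log ((discr K).natAbs) / 2) := by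
    rw [← Int.cast_abs, ← Nat.cast_natAbs, Real.sqrt_eq_rpow,
      Real.rpow_def_of_pos hdn]
    congr 1; ring
  have hr : ((Ideal.absNorm (classRep K C : Ideal (𝓞 K)) : ℝ) * Real.sqrt |(discr K : ℝ)|)⁻¹ =
      Real.exp (-(Real.log (Ideal.absNorm (classRep K C : Ideal (𝓞 K))) +
        Real.log ((discr K).natAbs) / 2)) := by
    rw [Real.exp_neg, Real.exp_add, Real.exp_log hnC, ← hsq]
  rw [FractionalIdeal.coeIdeal_absNorm, Rat.cast_natCast, hr, Complex.ofReal_exp]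
  simp only [Complex.ofReal_neg, Complex.ofReal_add, Complex.ofReal_div, Complex.ofReal_ofNat]

/-- **Discharge of `completedDedekindZeta_one_sub`: Hecke's functional equation
`Λ_K(1 - s) = Λ_K(s)`** for the completed Dedekind zeta function
`Λ_K(s) = |d_K|^{s/2} Γ_ℝ(s)^{r₁} Γ_ℂ(s)^{r₂} ζ_K(s)` of an arbitrary number field `K`, off the
integers (Hecke 1917; Neukirch, *Algebraic Number Theory* VII (5.10) Corollary). Proof along
Neukirch VII §5 as formalised in this directory: `Λ_K(s) = 2^{r₂} c_K⁻¹ w⁻¹ ∑_C |d_K|^{s/2}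
𝔑(J_C)^s Λ_{J_C}(s/2)` over the ideal classes (`dedekindZetaCont_eq_sum_classFrontFactor_mul_Λ`,
`dedekindGammaFactor_eq`), Mathlib's Mellin principle `Λ_J(1/2 - z) = ε_J Λ_{J^symm}(z)`
(`WeakFEPair.functional_equation`, VII (1.4)) with `J^symm` the FE-pair of the dual ideal
`(J𝔡)⁻¹` (`heckePair_symm`, theta transformation VII (3.6)), the class-invariance of
`𝔑(𝔞)^{2z} Λ_𝔞(z)` (`heckePair_Λ_spanSingleton_mul`) and the re-indexing `C ↦ [𝔡] C⁻¹` of the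
class group (`exists_classDuality`). [cite: NeukirchANT1999, Ch. VII (5.10) Corollary] -/
theorem _root_.Literature.NumberTheory.LFunctions.completedDedekindZeta_one_sub_holds :
    completedDedekindZeta_one_sub (K := K) := by
  intro s hs
  have hinv := thetaIdeal_inv_holds K
  obtain ⟨σ, v, hσv⟩ := exists_classDuality (K := K)
  have hsZ : ∀ w : ℂ, (∀ n : ℤ, w ≠ n) → w ≠ 0 ∧ w ≠ 1 := fun w hw ↦
    ⟨by simpa using hw 0, by simpa using hw 1⟩
  have hs' : ∀ n : ℤ, 1 - s ≠ n := fun n h ↦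
    hs (1 - n) (by rw [← sub_sub_cancel 1 s, h]; push_cast; ring)
  obtain ⟨hs0, hs1⟩ := hsZ s hs
  -- abbreviations
  set d : ℂ := ((discr K).natAbs : ℂ) with hd
  set N : ClassGroup (𝓞 K) → ℂ := fun C ↦ (Ideal.absNorm (classRep K C : Ideal (𝓞 K)) : ℂ) with hN
  set L : ClassGroup (𝓞 K) → ℂ → ℂ := fun C z ↦ (classPair hinv C).Λ z with hL
  have hJ0 : ∀ C : ClassGroup (𝓞 K), (((classRep K C : (Ideal (𝓞 K))⁰) : Ideal (𝓞 K)) :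
      FractionalIdeal (𝓞 K)⁰ K) ≠ 0 := fun C ↦ coeIdeal_ne_zero_of_mem_nonZeroDivisors (classRep K C)
  -- Step 1: `Λ_K(w) = 2^{r₂} c⁻¹ w⁻¹ ∑_C d^{w/2} N_C^w Λ_C(w/2)` off the integers
  have hΛK : ∀ w : ℂ, (∀ n : ℤ, w ≠ n) → completedDedekindZeta K w =
      2 ^ nrComplexPlaces K * ((heckeCst K : ℂ))⁻¹ * ((torsionOrder K : ℂ))⁻¹ *
        ∑ C, d ^ (w / 2) * N C ^ w * L C (w / 2) := by
    intro w hw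
    obtain ⟨hw0, hw1⟩ := hsZ w hw
    rw [completedDedekindZeta, dedekindGammaFactor_eq,
      dedekindZetaCont_eq_sum_classFrontFactor_mul_Λ hinv hw0 hw1, Finset.mul_sum, Finset.mul_sum]
    refine Finset.sum_congr rfl fun C _ ↦ ?_
    have hA := gammaFactorC_half_ne_zero (K := K) hw
    simp only [hd, hN, hL, classFrontFactor]
    field_simp
  -- Step 2: the functional equation of each class, moved to the representative of `σ C`
  have hFE : ∀ C, L C ((1 - s) / 2) = (classPair hinv C).ε *
      (((|(Algebra.norm ℚ (v C) : ℚ)| : ℝ) : ℂ) ^ (-s) * L (σ C) (s / 2)) := by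
    intro C
    have h1 := (classPair hinv C).functional_equation (s / 2)
    have hk : ((classPair hinv C).k : ℂ) - s / 2 = (1 - s) / 2 := by
      show ((1 / 2 : ℝ) : ℂ) - s / 2 = (1 - s) / 2; push_cast; ring
    rw [hk, smul_eq_mul] at h1
    simp only [hL]
    rw [h1]
    congr 1
    have h2 : (classPair hinv C).symm = heckePair K hinv (FractionalIdeal.dual ℤ ℚ _)
        (FractionalIdeal.dual_ne_zero ℤ ℚ (hJ0 C)) := heckePair_symm hinv _ (hJ0 C)
    have hxI : FractionalIdeal.spanSingleton (𝓞 K)⁰ (v C) *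
        (((classRep K (σ C) : (Ideal (𝓞 K))⁰) : Ideal (𝓞 K)) : FractionalIdeal (𝓞 K)⁰ K) ≠ 0 :=
      mul_ne_zero (FractionalIdeal.spanSingleton_ne_zero_iff.mpr (hσv C).1) (hJ0 (σ C))
    have hz0 : s / 2 ≠ 0 := div_ne_zero hs0 two_ne_zero
    have hzk : s / 2 ≠ ((1 / 2 : ℝ) : ℂ) := by
      intro h; apply hs1
      have := congr_arg (fun z : ℂ ↦ 2 * z) h
      push_cast at this
      linear_combination this
    rw [h2, heckePair_congr hinv (hσv C).2.1 _ hxI,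
      heckePair_Λ_spanSingleton_mul hinv (hσv C).1 _ (hJ0 (σ C)) hxI hz0 hzk,
      show -(2 * (s / 2)) = -s by ring]
    rfl
  -- Step 3: the coefficients match after re-indexing
  have hcoef : ∀ C, d ^ ((1 - s) / 2) * N C ^ (1 - s) * ((classPair hinv C).ε *
      (((|(Algebra.norm ℚ (v C) : ℚ)| : ℝ) : ℂ) ^ (-s))) = d ^ (s / 2) * N (σ C) ^ s := by
    intro C
    have hnC : (0 : ℝ) < Ideal.absNorm (classRep K C : Ideal (𝓞 K)) :=
      Nat.cast_pos.mpr (Ideal.absNorm_pos_of_nonZeroDivisors (classRep K C))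
    have hnD : (0 : ℝ) < Ideal.absNorm (classRep K (σ C) : Ideal (𝓞 K)) :=
      Nat.cast_pos.mpr (Ideal.absNorm_pos_of_nonZeroDivisors (classRep K (σ C)))
    have hdn : (0 : ℝ) < (discr K).natAbs := Nat.cast_pos.mpr (Int.natAbs_pos.mpr (discr_ne_zero K))
    have hav : (0 : ℝ) < |((Algebra.norm ℚ (v C) : ℚ) : ℝ)| := by
      have : (Algebra.norm ℚ (v C) : ℚ) ≠ 0 := Algebra.norm_ne_zero_iff.mpr (hσv C).1
      positivity
    -- the norm relation, as a relation between logarithms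
    have hprod : (Ideal.absNorm (classRep K (σ C) : Ideal (𝓞 K)) : ℝ) * (discr K).natAbs *
        Ideal.absNorm (classRep K C : Ideal (𝓞 K)) * |((Algebra.norm ℚ (v C) : ℚ) : ℝ)| = 1 := by
      have := congr_arg (Rat.cast : ℚ → ℝ) (hσv C).2.2
      push_cast at this
      exact this
    have hlog : Real.log (Ideal.absNorm (classRep K (σ C) : Ideal (𝓞 K))) +
        Real.log ((discr K).natAbs) + Real.log (Ideal.absNorm (classRep K C : Ideal (𝓞 K))) +
        Real.log |((Algebra.norm ℚ (v C) : ℚ) : ℝ)| = 0 := by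
      have := congr_arg Real.log hprod
      rwa [Real.log_mul (by positivity) hav.ne', Real.log_mul (by positivity) hnC.ne',
        Real.log_mul hnD.ne' hdn.ne', Real.log_one] at this
    have hlogC := congr_arg (fun x : ℝ ↦ (x : ℂ)) hlog
    simp only [Complex.ofReal_add, Complex.ofReal_zero] at hlogC
    -- everything as exponentials
    have hd' : d = (((discr K).natAbs : ℝ) : ℂ) := by rw [hd, Complex.ofReal_natCast]
    have hNC : N C = ((Ideal.absNorm (classRep K C : Ideal (𝓞 K)) : ℝ) : ℂ) := by
      rw [hN]; simp only [Complex.ofReal_natCast]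
    have hND : N (σ C) = ((Ideal.absNorm (classRep K (σ C) : Ideal (𝓞 K)) : ℝ) : ℂ) := by
      rw [hN]; simp only [Complex.ofReal_natCast]
    rw [hd', hNC, hND, ofReal_cpow_eq_exp hdn, ofReal_cpow_eq_exp hdn, ofReal_cpow_eq_exp hnC,
      ofReal_cpow_eq_exp hnD, ofReal_cpow_eq_exp hav, classPair_ε_eq_exp hinv C,
      ← Complex.exp_add, ← Complex.exp_add, ← Complex.exp_add, ← Complex.exp_add]
    congr 1
    linear_combination (-s) * hlogC
  -- Step 4: assemble
  rw [hΛK (1 - s) hs', hΛK s hs]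
  congr 1
  calc ∑ C, d ^ ((1 - s) / 2) * N C ^ (1 - s) * L C ((1 - s) / 2)
      = ∑ C, d ^ (s / 2) * N (σ C) ^ s * L (σ C) (s / 2) := by
        refine Finset.sum_congr rfl fun C _ ↦ ?_
        rw [hFE C, ← hcoef C]; ring
    _ = ∑ C, d ^ (s / 2) * N C ^ s * L C (s / 2) :=
        σ.sum_comp (fun C ↦ d ^ (s / 2) * N C ^ s * L C (s / 2))

end Literature.NumberTheory.LFunctions.NumberField
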